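import Literature.Computability.AlgebraicComplexity.KIReductionBricksArith
import Literature.Computability.Complexity.TM2Iterate
import HarnessLib

/-!
# Kabanets–Impagliazzo, Cor. 12: the reduction machine, IV — rounds and levels

Eighth file of the discharge of the reduction fact
`Literature.Computability.AlgebraicComplexity.permanent01Graph_polyExists_preimage_PIT`
(`PermanentGraphNSUBEXP.lean`), continuing `KIReductionBricksArith.lean`. With the uses
(`useF`, `KIReductionBricksLayers.lean`), the unary sizes/offsets (`usF`, `unF`, `baseF`) and the
operand pieces (`gateOpF`, `varOpF`, `sum2F`, `prod2F`) we write the code of the explicit layout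
of `KIReductionLayout.lean`:

* `roundPieceF ⟨ctxR, 1ʲ⟩` — the code of `roundGates n P (i'+1) j G` (a use of `P i'` behind the
  minor layer of column `j`, the product by `x_{0j}`, the new partial identity), on the ROUND
  CONTEXT `ctxR = ⟨w₀, ⟨1^{i'}, ⟨1^G, ⟨1^{n²}, ⟨1^{|P (i'+1)|}, 1^{|P i'|}⟩⟩⟩⟩⟩` (`roundPieceF_apply`);
* `levelSuccPieceF ⟨w₀, 1^{i'}⟩` — the code of `levelSuccGates n P (i'+1) G_{i'+1} (gate (G_{i'+1} − 1))`
  (the use of `P (i'+1)` behind the identity layer, the fold of the rounds, the square and the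
  running sum; `levelSuccPieceF_apply`);
* the clip polynomials `roundQ`, `levelQ` with the structural bounds that unclip the two folds.

## References

* V. Kabanets, R. Impagliazzo, *Derandomizing polynomial identity tests means proving circuit
  lower bounds*, STOC 2003, Lemma 11 and proof of Cor. 12 (p. 358).
* S. Arora, B. Barak, *Computational Complexity: A Modern Approach*, CUP 2009, §1.3.
-/

noncomputable section

namespace Literature.Computability.AlgebraicComplexity

namespace KIReduction

open _root_.Computability Complexity Brick OracleCompose HashBricks Plumb Polynomial ArithCircuit

/-- `|1ᵏ| = k` (twins under the name `length_ones`, outside this file's import cone: `FineGrained/BKGadget.lean`,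
`MaxCutGadgetMachine.lean`, `MetaComplexity/UPSearchMachines.lean`). [folklore] -/
@[simp] theorem length_ones' (k : ℕ) : (ones k).length = k := by simp [ones]

/-! ### The round context and its accessors -/

/-- **The round context** of level `i' + 1` of the run on `w₀`:
`⟨w₀, ⟨1^{i'}, ⟨1^{G}, ⟨1^{n²}, ⟨1^{|P (i'+1)|}, 1^{|P i'|}⟩⟩⟩⟩⟩`, `G = levelBase (i'+1)`. [folklore] -/
def ctxR (w₀ : List Bool) (i' : ℕ) : List Bool :=
  boolPair w₀ (boolPair (ones i') (boolPair (ones (levelBase (nOf w₀) (blocksOf w₀) (i' + 1)))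
    (boolPair (ones (nOf w₀ * nOf w₀)) (boolPair (ones (Sz w₀ (i' + 1))) (ones (Sz w₀ i'))))))

/-- On a round record `z = ⟨ctxR, 1ʲ⟩`: the input `w₀`. [folklore] -/
def w0R : List Bool → List Bool := fstF ∘ fstF
/-- The level index `1^{i'}`. [folklore] -/
def ipR : List Bool → List Bool := nthF 1 ∘ fstF
/-- The offset `1^G`. [folklore] -/
def ugR : List Bool → List Bool := nthF 2 ∘ fstF
/-- `1^{n²}`. [folklore] -/
def unR : List Bool → List Bool := nthF 3 ∘ fstF
/-- `1^{|P (i'+1)|}`. [folklore] -/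
def usiR : List Bool → List Bool := nthF 4 ∘ fstF
/-- `1^{|P i'|}`. [folklore] -/
def uspR : List Bool → List Bool := sndPow 4 ∘ fstF
/-- The round index `1ʲ`. [folklore] -/
def jR : List Bool → List Bool := sndF

/-- `w0R ∈ FP`. [folklore] -/
theorem w0R_mem_FP : w0R ∈ FP := comp_mem_FP fstF_mem_FP fstF_mem_FP
/-- `ipR ∈ FP`. [folklore] -/
theorem ipR_mem_FP : ipR ∈ FP := comp_mem_FP (nthF_mem_FP 1) fstF_mem_FP
/-- `ugR ∈ FP`. [folklore] -/
theorem ugR_mem_FP : ugR ∈ FP := comp_mem_FP (nthF_mem_FP 2) fstF_mem_FP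
/-- `unR ∈ FP`. [folklore] -/
theorem unR_mem_FP : unR ∈ FP := comp_mem_FP (nthF_mem_FP 3) fstF_mem_FP
/-- `usiR ∈ FP`. [folklore] -/
theorem usiR_mem_FP : usiR ∈ FP := comp_mem_FP (nthF_mem_FP 4) fstF_mem_FP
/-- `uspR ∈ FP`. [folklore] -/
theorem uspR_mem_FP : uspR ∈ FP := comp_mem_FP (sndPow_mem_FP 4) fstF_mem_FP
/-- `jR ∈ FP`. [folklore] -/
theorem jR_mem_FP : jR ∈ FP := sndF_mem_FP

section Accessors

variable (w₀ : List Bool) (i' : ℕ) (u : List Bool)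

/-- `w0R` on a round record. [folklore] -/
@[simp] theorem w0R_ctxR : w0R (boolPair (ctxR w₀ i') u) = w₀ := by simp [w0R, ctxR]
/-- `ipR` on a round record. [folklore] -/
@[simp] theorem ipR_ctxR : ipR (boolPair (ctxR w₀ i') u) = ones i' := by simp [ipR, ctxR]
/-- `ugR` on a round record. [folklore] -/
@[simp] theorem ugR_ctxR : ugR (boolPair (ctxR w₀ i') u) = ones (levelBase (nOf w₀) (blocksOf w₀) (i' + 1)) := by
  simp [ugR, ctxR, nthF]
/-- `unR` on a round record. [folklore] -/
@[simp] theorem unR_ctxR : unR (boolPair (ctxR w₀ i') u) = ones (nOf w₀ * nOf w₀) := by simp [unR, ctxR, nthF]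
/-- `usiR` on a round record. [folklore] -/
@[simp] theorem usiR_ctxR : usiR (boolPair (ctxR w₀ i') u) = ones (Sz w₀ (i' + 1)) := by simp [usiR, ctxR, nthF]
/-- `uspR` on a round record. [folklore] -/
@[simp] theorem uspR_ctxR : uspR (boolPair (ctxR w₀ i') u) = ones (Sz w₀ i') := by simp [uspR, ctxR, sndPow]
/-- `jR` on a round record. [folklore] -/
@[simp] theorem jR_ctxR : jR (boolPair (ctxR w₀ i') u) = u := by simp [jR]

end Accessors

/-- Length of the round context: `2|w₀| + 2i' + 2 G + 2 n² + 2 |P(i'+1)| + |P i'| + 10`. [folklore] -/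
theorem length_ctxR (w₀ : List Bool) (i' : ℕ) : (ctxR w₀ i').length =
    2 * w₀.length + 2 * i' + 2 * levelBase (nOf w₀) (blocksOf w₀) (i' + 1) + 2 * (nOf w₀ * nOf w₀) +
      2 * Sz w₀ (i' + 1) + Sz w₀ i' + 10 := by
  simp only [ctxR, length_boolPair, ones, List.length_replicate]; ring

/-- The round context dominates: `|w₀|, n, G, … ≤ |ctxR|`. [folklore] -/
theorem le_length_ctxR (w₀ : List Bool) (i' : ℕ) :
    w₀.length ≤ (ctxR w₀ i').length ∧ i' ≤ (ctxR w₀ i').length ∧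
      levelBase (nOf w₀) (blocksOf w₀) (i' + 1) ≤ (ctxR w₀ i').length ∧ nOf w₀ * nOf w₀ ≤ (ctxR w₀ i').length ∧
        Sz w₀ (i' + 1) ≤ (ctxR w₀ i').length ∧ Sz w₀ i' ≤ (ctxR w₀ i').length := by
  rw [length_ctxR]; omega

/-! ### Unary index pieces of a round -/

/-- `1^{useLen (P (i'+1))}` on a round record. [folklore] -/
def uLiF : List Bool → List Bool := fun z => (unR z ++ usiR z) ++ [true]
/-- `1^{useLen (P i') + 2}` on a round record. [folklore] -/
def uLp3F : List Bool → List Bool := fun z => (unR z ++ uspR z) ++ [true, true, true]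
/-- `1^{roundBase}` on a round record: `1^G ++ 1^{useLen (P (i'+1))} ++ 1^{j (useLen (P i') + 2)}`. [folklore] -/
def rUF : List Bool → List Bool := fun z => (ugR z ++ uLiF z) ++ (umulFn ∘ fanoutFn jR uLp3F) z
/-- `1^{roundBase + useOut (P i')}` on a round record (the output of the round's use). [folklore] -/
def mUF : List Bool → List Bool := fun z => (rUF z ++ unR z) ++ uspR z

/-- `uLiF ∈ FP`. [folklore] -/
theorem uLiF_mem_FP : uLiF ∈ FP := append_mem_FP (append_mem_FP unR_mem_FP usiR_mem_FP) (const_mem_FP _)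
/-- `uLp3F ∈ FP`. [folklore] -/
theorem uLp3F_mem_FP : uLp3F ∈ FP := append_mem_FP (append_mem_FP unR_mem_FP uspR_mem_FP) (const_mem_FP _)
/-- `rUF ∈ FP`. [folklore] -/
theorem rUF_mem_FP : rUF ∈ FP :=
  append_mem_FP (append_mem_FP ugR_mem_FP uLiF_mem_FP) (comp_mem_FP umulFn_mem_FP (fanoutFn_mem_FP jR_mem_FP uLp3F_mem_FP))
/-- `mUF ∈ FP`. [folklore] -/
theorem mUF_mem_FP : mUF ∈ FP := append_mem_FP (append_mem_FP rUF_mem_FP unR_mem_FP) uspR_mem_FP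

section Values

variable (w₀ : List Bool) (i' j : ℕ)

/-- Value of `uLiF`. [folklore] -/
theorem uLiF_ctxR : uLiF (boolPair (ctxR w₀ i') (ones j)) = ones (useLen (nOf w₀) (blocksOf w₀ (i' + 1))) := by
  simp only [uLiF, unR_ctxR, usiR_ctxR, ones_useLen]

/-- Value of `uLp3F`. [folklore] -/
theorem uLp3F_ctxR : uLp3F (boolPair (ctxR w₀ i') (ones j)) = ones (useLen (nOf w₀) (blocksOf w₀ i') + 2) := by
  simp only [uLp3F, unR_ctxR, uspR_ctxR]
  rw [show [true, true, true] = [true] ++ ones 2 from rfl, ← List.append_assoc, ones_useLen, Com.ones_append]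

/-- **Value of `rUF`: the offset of round `j`.** [folklore] -/
theorem rUF_ctxR : rUF (boolPair (ctxR w₀ i') (ones j)) =
    ones (roundBase (nOf w₀) (blocksOf w₀) (i' + 1) j (levelBase (nOf w₀) (blocksOf w₀) (i' + 1))) := by
  simp only [rUF, Function.comp_apply, fanoutFn_apply, umulFn_apply, fstF_boolPair, sndF_boolPair, jR_ctxR,
    uLp3F_ctxR, uLiF_ctxR, ugR_ctxR, Com.ones_append, roundBase, Nat.add_sub_cancel]
  simp [ones]

/-- Value of `mUF`: the output index of the round's use. [folklore] -/
theorem mUF_ctxR : mUF (boolPair (ctxR w₀ i') (ones j)) =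
    ones (roundBase (nOf w₀) (blocksOf w₀) (i' + 1) j (levelBase (nOf w₀) (blocksOf w₀) (i' + 1)) +
      useOut (nOf w₀ * nOf w₀) (blocksOf w₀ i')) := by
  simp only [mUF, rUF_ctxR, unR_ctxR, uspR_ctxR, Com.ones_append, useOut, Sz, Nat.add_assoc]

end Values

/-! ### The round piece -/

/-- The use of `P i'` behind the minor layer of column `j`, at offset `roundBase`:
`useF minorOpF ⟨⟨bin (roundBase + 1), Bs_{i'}⟩, ⟨U, ⟨1^{i'}, 1ʲ⟩⟩⟩`. [cite: KabanetsImpagliazzo2003, Lemma 11 (2) (p. 358)] -/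
def roundUseF : List Bool → List Bool :=
  useF minorOpF ∘ fanoutFn
    (fanoutFn (lenBinF ∘ fun z => rUF z ++ [true]) (nthItemFn ∘ fanoutFn ipR (sndF ∘ w0R)))
    (fanoutFn (uF ∘ w0R) (fanoutFn ipR jR))

/-- The operand of the partial identity entering round `j`: for `j = 0` the output of the use of
`P (i'+1)` (`gate (G + useOut (P (i'+1)))`), else the last gate of round `j − 1` (`gate (roundBase − 1)`). [folklore] -/
def dOpF : List Bool → List Bool :=
  iteFn (isNilFn ∘ jR) (gateOpF fun z => (ugR z ++ unR z) ++ usiR z) (gateOpF (List.tail ∘ rUF))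

/-- **The round piece**: use, product `x_{0j} · out`, new partial identity `d − q`. [cite: KabanetsImpagliazzo2003, Lemma 11 (2) (p. 358)] -/
def roundPieceF : List Bool → List Bool :=
  fun z => (roundUseF z ++ prod2F (varOpF jR) (gateOpF mUF) z) ++ sum2F 1 (-1) dOpF (gateOpF fun z => mUF z ++ [true]) z

/-- `roundUseF ∈ FP`. [folklore] -/
theorem roundUseF_mem_FP : roundUseF ∈ FP :=
  comp_mem_FP (useF_mem_FP minorOpF_mem_FP) (fanoutFn_mem_FP
    (fanoutFn_mem_FP (comp_mem_FP lenBinF_mem_FP (append_mem_FP rUF_mem_FP (const_mem_FP _)))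
      (comp_mem_FP nthItemFn_mem_FP (fanoutFn_mem_FP ipR_mem_FP (comp_mem_FP sndF_mem_FP w0R_mem_FP))))
    (fanoutFn_mem_FP (comp_mem_FP uF_mem_FP w0R_mem_FP) (fanoutFn_mem_FP ipR_mem_FP jR_mem_FP)))

/-- `dOpF ∈ FP`. [folklore] -/
theorem dOpF_mem_FP : dOpF ∈ FP :=
  iteFn_mem_FP (comp_mem_FP isNilFn_mem_FP jR_mem_FP)
    (gateOpF_mem_FP (append_mem_FP (append_mem_FP ugR_mem_FP unR_mem_FP) usiR_mem_FP))
    (gateOpF_mem_FP (comp_mem_FP PRelSigma.tail_mem_FP rUF_mem_FP))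

/-- `roundPieceF ∈ FP`. [folklore] -/
theorem roundPieceF_mem_FP : roundPieceF ∈ FP :=
  append_mem_FP (append_mem_FP roundUseF_mem_FP (prod2F_mem_FP (varOpF_mem_FP jR_mem_FP) (gateOpF_mem_FP mUF_mem_FP)))
    (sum2F_mem_FP 1 (-1) dOpF_mem_FP (gateOpF_mem_FP (append_mem_FP mUF_mem_FP (const_mem_FP _))))

/-- `⟨c, w⟩ = ⟨c, ε⟩ ++ w` (private copy of a generic lemma held outside this file's import cone:
`FarCertMachine.boolPair_eq_append`, `Algebra/EuclideanLattices/FarCertMachineCodes.lean`). [folklore] -/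
private theorem boolPair_eq_frame_append₁ (c w : List Bool) : boolPair c w = boolPair c [] ++ w := by
  simp [boolPair, List.append_assoc]

/-- `encList` of a two-element list is two frames. [folklore] -/
theorem encList_pair (a b : List Bool) : encList [a, b] = boolPair a [] ++ boolPair b [] := by
  rw [encList_cons, encList_cons, encList_nil, boolPair_eq_frame_append₁ a]

/-- The use of the round, spelled out as a `useF` record. [folklore] -/
theorem roundUseF_eq (w₀ : List Bool) (i' j : ℕ) :
    roundUseF (boolPair (ctxR w₀ i') (ones j)) =
      useF minorOpF (boolPair
        (boolPair (encodeNat (roundBase (nOf w₀) (blocksOf w₀) (i' + 1) j (levelBase (nOf w₀) (blocksOf w₀) (i' + 1)) + 1))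
          (bsStr w₀ i'))
        (boolPair (uStr w₀) (boolPair (ones i') (ones j)))) := by
  rw [roundUseF, Function.comp_apply]
  simp only [fanoutFn_apply, Function.comp_apply, rUF_ctxR, w0R_ctxR, ipR_ctxR, jR_ctxR, uF_apply, nthItemFn_boolPair,
    lenBinF_apply, List.length_append, List.length_singleton, ones, List.length_replicate]
  rfl

/-- **Value of the round piece**: the list code of the codes of `roundGates n P (i'+1) j G`
(`j < i' + 1 ≤ n`). [cite: KabanetsImpagliazzo2003, Lemma 11 (2) (p. 358)] -/
theorem roundPieceF_apply (w₀ : List Bool) {i' j : ℕ} (hi : i' + 1 ≤ nOf w₀) (hj : j < i' + 1) :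
    roundPieceF (boolPair (ctxR w₀ i') (ones j)) =
      encList ((roundGates (nOf w₀) (blocksOf w₀) (i' + 1) j (levelBase (nOf w₀) (blocksOf w₀) (i' + 1))).map
        (gateCode (nOf w₀ * nOf w₀))) := by
  set n := nOf w₀ with hn
  set P := blocksOf w₀ with hP
  set G := levelBase n P (i' + 1) with hG
  have hjn : j < n * n := lt_of_lt_of_le (by omega) (Nat.le_mul_self n)
  -- the use
  have hU : (uStr w₀).length = n := rfl
  have huse : roundUseF (boolPair (ctxR w₀ i') (ones j)) =
      encList ((useGates (roundBase n P (i' + 1) j G) (minorLayer n (i' + 1) j) (P i')).map (gateCode (n * n))) := by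
    rw [roundUseF_eq, ← hn, ← hP, ← hG,
      useF_apply (U := uStr w₀) (prm := boolPair (ones i') (ones j)) (opShort_minorOpF (uStr w₀) i' j (hU ▸ hi))
        (L := minorLayer n (i' + 1) j) (fun a b ha hb => minorOpF_apply (uStr w₀) i' j ha hb (hU ▸ hi))]
    rfl
  -- the product `x_{0j} · out`
  have hprod : prod2F (varOpF jR) (gateOpF mUF) (boolPair (ctxR w₀ i') (ones j)) =
      boolPair (gateCode (n * n) (.prod [(varEntry n j).toOperand,
        .gate (roundBase n P (i' + 1) j G + useOut (n * n) (P i'))])) [] := by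
    refine prod2F_apply ?_ ?_
    · rw [varOpF_apply (n := n) jR _ (by simpa [ones] using hjn)]; simp [ones]
    · rw [gateOpF_apply (n * n), mUF_ctxR]; simp [ones, ← hn, ← hP, ← hG]
  -- the new partial identity `d − q`
  have hd : dOpF (boolPair (ctxR w₀ i') (ones j)) = opCode (n * n) (dAfter n P (i' + 1) G j) := by
    unfold dOpF dAfter
    by_cases h0 : j = 0
    · subst h0
      rw [iteFn_apply_true (by simp [isNilFn, ones]), if_pos rfl, gateOpF_apply (n * n)]
      simp only [ugR_ctxR, unR_ctxR, usiR_ctxR, Com.ones_append, useOut, Sz]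
      simp [ones, ← hn, ← hP, ← hG, Nat.add_assoc]
    · rw [iteFn_apply_false (by simp [isNilFn, ones, h0]), if_neg h0, gateOpF_apply (n * n)]
      simp only [Function.comp_apply, rUF_ctxR]
      simp [ones, ← hn, ← hP, ← hG]
  have hsum : sum2F 1 (-1) dOpF (gateOpF fun z => mUF z ++ [true]) (boolPair (ctxR w₀ i') (ones j)) =
      boolPair (gateCode (n * n) (.sum [(1, dAfter n P (i' + 1) G j),
        (-1, .gate (roundBase n P (i' + 1) j G + useOut (n * n) (P i') + 1))])) [] := by
    refine sum2F_apply 1 (-1) hd ?_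
    rw [gateOpF_apply (n * n), mUF_ctxR]; simp [ones, ← hn, ← hP, ← hG]
  rw [roundPieceF, huse, hprod, hsum, roundGates, List.map_append, encList_append, List.map_cons, List.map_cons,
    List.map_nil, encList_pair, Nat.add_sub_cancel, List.append_assoc]

/-! ### The structural bound of the round piece -/

/-- The clip polynomial of the rounds fold (in the length `C` of the round context). [folklore] -/
def roundQ : Polynomial ℕ :=
  8 + X * rowQ.comp (5 * X + 4) + X * (12 * (4 * X ^ 2 + 13 * X + 6) + 202) +
    (4 * ((X + 2) + (2 * X ^ 2 + 8 * X + 3)) + 24) + (4 * ((2 * X ^ 2 + 6 * X + 2) + (2 * X ^ 2 + 8 * X + 4)) + 120)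

/-- The offset of a round of the run is at most `2 C² + 6 C + 1`, `C` the length of the round
context (`j ≤ i' + 1`). [folklore] -/
theorem roundBase_le_ctxR (w₀ : List Bool) {i' j : ℕ} (hj : j ≤ i' + 1) :
    roundBase (nOf w₀) (blocksOf w₀) (i' + 1) j (levelBase (nOf w₀) (blocksOf w₀) (i' + 1)) ≤
      2 * (ctxR w₀ i').length ^ 2 + 6 * (ctxR w₀ i').length + 1 := by
  obtain ⟨h0, h1, h2, h3, h4, h5⟩ := le_length_ctxR w₀ i'
  have hi1 : i' + 1 ≤ (ctxR w₀ i').length := by rw [length_ctxR]; omega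
  set C := (ctxR w₀ i').length
  simp only [Sz] at h4 h5
  simp only [roundBase, useLen, Nat.add_sub_cancel]
  have hj' : j ≤ C := hj.trans hi1
  have : j * (nOf w₀ * nOf w₀ + (blocksOf w₀ i').length + 1 + 2) ≤ C * (C + C + 3) := Nat.mul_le_mul hj' (by omega)
  nlinarith

/-- **The round piece is within the clip** (`j < i' + 1 ≤ n`). [folklore] -/
theorem length_roundPieceF_le (w₀ : List Bool) {i' j : ℕ} (hi : i' + 1 ≤ nOf w₀) (hj : j < i' + 1) :
    (roundPieceF (boolPair (ctxR w₀ i') (ones j))).length ≤ roundQ.eval (ctxR w₀ i').length := by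
  obtain ⟨h0, h1, h2, h3, h4, h5⟩ := le_length_ctxR w₀ i'
  have hr := roundBase_le_ctxR w₀ (Nat.le_of_lt hj)
  set C := (ctxR w₀ i').length with hC
  have hn : nOf w₀ ≤ C := (nOf_le w₀).trans h0
  have hU : (uStr w₀).length = nOf w₀ := rfl
  simp only [Sz] at h4 h5
  -- the use
  have huse : (roundUseF (boolPair (ctxR w₀ i') (ones j))).length ≤
      8 + C * rowQ.eval (5 * C + 4) + C * (12 * (4 * C ^ 2 + 13 * C + 6) + 202) := by
    rw [roundUseF_eq]
    refine (length_useF_le (opShort_minorOpF (uStr w₀) i' j (hU ▸ hi)) _ _).trans ?_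
    have hBs : (bsStr w₀ i').length ≤ C := (length_bsStr_le w₀ i').trans h0
    have hbin : (encodeNat (roundBase (nOf w₀) (blocksOf w₀) (i' + 1) j (levelBase (nOf w₀) (blocksOf w₀) (i' + 1)) + 1)).length ≤
        2 * C ^ 2 + 6 * C + 2 := (length_encodeNat_le_self _).trans (by omega)
    have hctx : (boolPair (uStr w₀) (boolPair (ones i') (ones j))).length ≤ 5 * C + 4 := by
      simp only [length_boolPair, ones, List.length_replicate, hU]; omega
    have hpair : (boolPair (encodeNat (roundBase (nOf w₀) (blocksOf w₀) (i' + 1) j (levelBase (nOf w₀) (blocksOf w₀) (i' + 1)) + 1))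
        (bsStr w₀ i')).length ≤ 4 * C ^ 2 + 13 * C + 6 := by
      simp only [length_boolPair]; omega
    have e1 : (uStr w₀).length * rowQ.eval (boolPair (uStr w₀) (boolPair (ones i') (ones j))).length ≤ C * rowQ.eval (5 * C + 4) :=
      Nat.mul_le_mul (hU ▸ hn) (TM2Iter.eval_mono rowQ hctx)
    have e2 : (bsStr w₀ i').length *
        (12 * (boolPair (encodeNat (roundBase (nOf w₀) (blocksOf w₀) (i' + 1) j (levelBase (nOf w₀) (blocksOf w₀) (i' + 1)) + 1))
          (bsStr w₀ i')).length + 202) ≤ C * (12 * (4 * C ^ 2 + 13 * C + 6) + 202) := Nat.mul_le_mul hBs (by omega)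
    omega
  -- the product
  have hprod : (prod2F (varOpF jR) (gateOpF mUF) (boolPair (ctxR w₀ i') (ones j))).length ≤
      4 * ((C + 2) + (2 * C ^ 2 + 8 * C + 3)) + 24 := by
    rw [length_prod2F]
    have a := length_varOpF_le jR (boolPair (ctxR w₀ i') (ones j))
    have b := length_gateOpF_le mUF (boolPair (ctxR w₀ i') (ones j))
    rw [jR_ctxR] at a
    rw [mUF_ctxR] at b
    simp only [length_ones', useOut] at a b
    have : j ≤ C := (Nat.le_of_lt_succ hj).trans h1
    omega
  -- the new partial identity
  have hsum : (sum2F 1 (-1) dOpF (gateOpF fun z => mUF z ++ [true]) (boolPair (ctxR w₀ i') (ones j))).length ≤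
      4 * ((2 * C ^ 2 + 6 * C + 2) + (2 * C ^ 2 + 8 * C + 4)) + 120 := by
    rw [length_sum2F]
    have hd : (dOpF (boolPair (ctxR w₀ i') (ones j))).length ≤ 2 * C ^ 2 + 6 * C + 2 := by
      unfold dOpF
      rw [iteFn_of_oneBit (oneBit_isNilFn.comp _)]
      split_ifs
      · refine (length_gateOpF_le _ _).trans ?_
        simp only [ugR_ctxR, unR_ctxR, usiR_ctxR, List.length_append, length_ones', Sz]
        omega
      · refine (length_gateOpF_le _ _).trans ?_
        simp only [Function.comp_apply, rUF_ctxR, List.length_tail, length_ones']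
        omega
    have b := length_gateOpF_le (fun z => mUF z ++ [true]) (boolPair (ctxR w₀ i') (ones j))
    simp only [mUF_ctxR, List.length_append, List.length_singleton, length_ones', useOut] at b
    have i1 : (intCode 1).length = 5 := by simp [intCode_one]
    have i2 : (intCode (-1)).length = 5 := by simp [intCode_neg_one]
    omega
  simp only [roundPieceF, List.length_append, roundQ, Polynomial.eval_add, Polynomial.eval_mul, Polynomial.eval_pow,
    Polynomial.eval_X, Polynomial.eval_ofNat, Polynomial.eval_comp]
  omega

/-! ### The level piece (levels `i' + 1`, `i' < n`) -/

/-- The round-context brick on the level record `⟨w₀, 1^{i'}⟩`. [folklore] -/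
def ctxRF : List Bool → List Bool :=
  fanoutFn fstF (fanoutFn sndF (fanoutFn (baseF ∘ fanoutFn fstF (List.cons true ∘ sndF))
    (fanoutFn (unF ∘ fstF) (fanoutFn (usF ∘ fanoutFn fstF (List.cons true ∘ sndF)) usF))))

/-- `ctxRF ∈ FP`. [folklore] -/
theorem ctxRF_mem_FP : ctxRF ∈ FP :=
  fanoutFn_mem_FP fstF_mem_FP (fanoutFn_mem_FP sndF_mem_FP (fanoutFn_mem_FP
    (comp_mem_FP baseF_mem_FP (fanoutFn_mem_FP fstF_mem_FP (comp_mem_FP (cons_mem_FP true) sndF_mem_FP)))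
    (fanoutFn_mem_FP (comp_mem_FP unF_mem_FP fstF_mem_FP)
      (fanoutFn_mem_FP (comp_mem_FP usF_mem_FP (fanoutFn_mem_FP fstF_mem_FP (comp_mem_FP (cons_mem_FP true) sndF_mem_FP))) usF_mem_FP))))

/-- **Value of the round-context brick** (`i' + 1 ≤ |w₀| + 1`). [folklore] -/
theorem ctxRF_apply (w₀ : List Bool) {i' : ℕ} (hi : i' ≤ w₀.length) : ctxRF (boolPair w₀ (ones i')) = ctxR w₀ i' := by
  simp only [ctxRF, fanoutFn_apply, Function.comp_apply, fstF_boolPair, sndF_boolPair, true_cons_ones, unF_apply,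
    usF_apply, ones, List.length_replicate]
  rw [← ones, ← ones, baseF_apply w₀ _ (by simp [ones]; omega)]
  simp [ctxR, ones]

/-- The record on which the closing gates of the level are written: the round context with the
index `1^{i'+1}` (so that `rUF` is the offset after the last round). [folklore] -/
def endRecF : List Bool → List Bool := fanoutFn ctxRF (List.cons true ∘ sndF)

/-- `endRecF ∈ FP`. [folklore] -/
theorem endRecF_mem_FP : endRecF ∈ FP := fanoutFn_mem_FP ctxRF_mem_FP (comp_mem_FP (cons_mem_FP true) sndF_mem_FP)

/-- Value of `endRecF`. [folklore] -/
theorem endRecF_apply (w₀ : List Bool) {i' : ℕ} (hi : i' ≤ w₀.length) :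
    endRecF (boolPair w₀ (ones i')) = boolPair (ctxR w₀ i') (ones (i' + 1)) := by
  simp only [endRecF, fanoutFn_apply, Function.comp_apply, sndF_boolPair, ctxRF_apply w₀ hi, true_cons_ones]

/-- The use of `P (i'+1)` behind the identity layer at the level offset:
`useF idOpF ⟨⟨bin (G + 1), Bs_{i'+1}⟩, ⟨U, ε⟩⟩`, written on the level record. [cite: KabanetsImpagliazzo2003, Lemma 11 (2) (p. 358)] -/
def levelUseF : List Bool → List Bool :=
  useF idOpF ∘ fanoutFn
    (fanoutFn (lenBinF ∘ fun z => (ugR ∘ endRecF) z ++ [true]) (bsF ∘ fanoutFn fstF (List.cons true ∘ sndF)))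
    (fanoutFn (uF ∘ fstF) (fun _ => []))

/-- `levelUseF ∈ FP`. [folklore] -/
theorem levelUseF_mem_FP : levelUseF ∈ FP :=
  comp_mem_FP (useF_mem_FP idOpF_mem_FP) (fanoutFn_mem_FP
    (fanoutFn_mem_FP (comp_mem_FP lenBinF_mem_FP (append_mem_FP (comp_mem_FP ugR_mem_FP endRecF_mem_FP) (const_mem_FP _)))
      (comp_mem_FP bsF_mem_FP (fanoutFn_mem_FP fstF_mem_FP (comp_mem_FP (cons_mem_FP true) sndF_mem_FP))))
    (fanoutFn_mem_FP (comp_mem_FP uF_mem_FP fstF_mem_FP) (const_mem_FP _)))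

/-- The closing gates of the level, on the end record: the square of the identity and the new
running sum `gate (G − 1) + square`. [folklore] -/
def closeF : List Bool → List Bool :=
  fun z => prod2F (gateOpF (List.tail ∘ rUF)) (gateOpF (List.tail ∘ rUF)) z ++
    sum2F 1 1 (gateOpF (List.tail ∘ ugR)) (gateOpF rUF) z

/-- `closeF ∈ FP`. [folklore] -/
theorem closeF_mem_FP : closeF ∈ FP :=
  append_mem_FP (prod2F_mem_FP (gateOpF_mem_FP (comp_mem_FP PRelSigma.tail_mem_FP rUF_mem_FP))
    (gateOpF_mem_FP (comp_mem_FP PRelSigma.tail_mem_FP rUF_mem_FP)))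
    (sum2F_mem_FP 1 1 (gateOpF_mem_FP (comp_mem_FP PRelSigma.tail_mem_FP ugR_mem_FP)) (gateOpF_mem_FP rUF_mem_FP))

/-- **The level piece** on `⟨w₀, 1^{i'}⟩`: use, the fold of the rounds over `i' + 1` rounds, the
closing gates. [cite: KabanetsImpagliazzo2003, Lemma 11 (2) (p. 358)] -/
def levelSuccPieceF : List Bool → List Bool :=
  fun z => (levelUseF z ++ (foldCat roundQ (X + 1) roundPieceF ∘ endRecF) z) ++ (closeF ∘ endRecF) z

/-- `levelSuccPieceF ∈ FP`. [folklore] -/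
theorem levelSuccPieceF_mem_FP : levelSuccPieceF ∈ FP :=
  append_mem_FP (append_mem_FP levelUseF_mem_FP (comp_mem_FP (foldCat_mem_FP _ _ roundPieceF_mem_FP) endRecF_mem_FP))
    (comp_mem_FP closeF_mem_FP endRecF_mem_FP)

/-- `encList` over the rounds is the concatenation of the round codes. [folklore] -/
theorem encList_map_roundsGates (n : ℕ) (P : ℕ → KBlock) (i G : ℕ) : ∀ m,
    encList ((roundsGates n P i G m).map (gateCode (n * n))) =
      ccat (fun j => encList ((roundGates n P i j G).map (gateCode (n * n)))) m
  | 0 => rfl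
  | m + 1 => by
    rw [show roundsGates n P i G (m + 1) = roundsGates n P i G m ++ roundGates n P i m G from rfl, List.map_append,
      encList_append, encList_map_roundsGates n P i G m, ccat_succ]

/-- **Value of the level piece**: the list code of the codes of
`levelSuccGates n P (i'+1) G_{i'+1} (gate (G_{i'+1} − 1))` (`i' + 1 ≤ n`). [cite: KabanetsImpagliazzo2003, Lemma 11 (2) (p. 358)] -/
theorem levelSuccPieceF_apply (w₀ : List Bool) {i' : ℕ} (hi : i' + 1 ≤ nOf w₀) :
    levelSuccPieceF (boolPair w₀ (ones i')) =
      encList ((levelSuccGates (nOf w₀) (blocksOf w₀) (i' + 1) (levelBase (nOf w₀) (blocksOf w₀) (i' + 1))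
        (.gate (levelBase (nOf w₀) (blocksOf w₀) (i' + 1) - 1))).map (gateCode (nOf w₀ * nOf w₀))) := by
  set n := nOf w₀ with hn
  set P := blocksOf w₀ with hP
  set G := levelBase n P (i' + 1) with hG
  have hiw : i' ≤ w₀.length := by have := nOf_le w₀; omega
  have hU : (uStr w₀).length = n := rfl
  have hend := endRecF_apply w₀ hiw
  -- the use of `P (i'+1)` behind the identity layer
  have huse : levelUseF (boolPair w₀ (ones i')) = encList ((useGates G (idL n) (P (i' + 1))).map (gateCode (n * n))) := by
    rw [levelUseF, Function.comp_apply]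
    simp only [fanoutFn_apply, Function.comp_apply, hend, ugR_ctxR, fstF_boolPair, sndF_boolPair, true_cons_ones,
      bsF_apply, uF_apply, lenBinF_apply, List.length_append, List.length_singleton, ones, List.length_replicate]
    rw [← hn, ← hP, ← hG]
    have h := useF_apply (U := uStr w₀) (prm := []) (opShort_idOpF (uStr w₀) []) (L := idL n)
      (fun a b ha hb => idOpF_apply (uStr w₀) [] ha hb) G (bsStr w₀ (i' + 1))
    rw [h]
    rfl
  -- the rounds
  have hrounds : foldCat roundQ (X + 1) roundPieceF (boolPair (ctxR w₀ i') (ones (i' + 1))) =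
      encList ((roundsGates n P (i' + 1) G (i' + 1)).map (gateCode (n * n))) := by
    rw [foldCat_apply (p := X + 1) (by simp [ones]; exact (le_length_ctxR w₀ i').2.1)
      (fun t ht => by rw [ones, List.length_replicate] at ht; exact length_roundPieceF_le w₀ hi ht)]
    rw [encList_map_roundsGates]
    simp only [ones, List.length_replicate]
    exact ccat_congr fun j hj => roundPieceF_apply w₀ hi hj
  -- the closing gates
  have hclose : closeF (boolPair (ctxR w₀ i') (ones (i' + 1))) =
      boolPair (gateCode (n * n) (.prod [dAfter n P (i' + 1) G (i' + 1), dAfter n P (i' + 1) G (i' + 1)])) [] ++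
        boolPair (gateCode (n * n) (.sum [(1, .gate (G - 1)), (1, .gate (roundBase n P (i' + 1) (i' + 1) G))])) [] := by
    have hd : gateOpF (List.tail ∘ rUF) (boolPair (ctxR w₀ i') (ones (i' + 1))) = opCode (n * n) (dAfter n P (i' + 1) G (i' + 1)) := by
      rw [gateOpF_apply (n * n), dAfter, if_neg (Nat.succ_ne_zero i')]
      simp [rUF_ctxR, ones, ← hn, ← hP, ← hG]
    rw [closeF, prod2F_apply hd hd, sum2F_apply 1 1]
    · rw [gateOpF_apply (n * n)]; simp [ugR_ctxR, ones, ← hn, ← hP, ← hG]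
    · rw [gateOpF_apply (n * n), rUF_ctxR]; simp [ones, ← hn, ← hP, ← hG]
  rw [levelSuccPieceF]
  simp only [Function.comp_apply, hend]
  rw [huse, hrounds, hclose, levelSuccGates, List.map_append, List.map_append, encList_append, encList_append,
    List.map_cons, List.map_cons, List.map_nil, encList_pair, List.append_assoc]

end KIReduction

end Literature.Computability.AlgebraicComplexity

end
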